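import Literature.AnabelianGeometry.SemiGraphs.ArithMaximalCompact
import Literature.AnabelianGeometry.SemiGraphs.TemperedCompactInVerticialCaseA
import Literature.AnabelianGeometry.SemiGraphs.InverseSystemEventuallySingleton
import Literature.AnabelianGeometry.SemiGraphs.SubdivisionPaths
import Literature.AnabelianGeometry.SemiGraphs.FreeGroupsAndActionsProofs2
import Literature.AnabelianGeometry.SemiGraphs.MorphismsOver
import HarnessLib

/-!
# [SemiAnbd] Thm 5.4 (i), CLAUSE 1 «every arithmetically ample compact subgroup lies in a verticial
# subgroup» — over arithmetic level data, for subgroups satisfying (∗_j) (sub-DAG Thm54, row T54-3b)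

Mochizuki, *Semi-graphs of anabelioids*, Publ. RIMS **42** (2006) 221–322, §5, Theorem 5.4 (i), manuscript
p. 66 [cite: MochizukiSemiAnbd2006, Thm 5.4 (i) p.66]: "Every arithmetically ample compact subgroup of
`π₁^temp(𝔊)` is contained in at least one verticial subgroup", proof: "entirely parallel to [that] of
Theorem 3.7" — i.e. the tree argument of p. 41 read through the author's Comments (6) (May 2020): "(a)
Suppose that for some cofinal subset `J ⊆ I`, we have `#V_j = 1` … the unique elements of the `V_j` …
form a compatible system of vertices fixed by `H`. Thus … `H` is contained in some verticial subgroup. (b)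
Suppose … `#V_j ≥ 2` … (∗_j) … the unique elements of the `E_{j,∞}` form a compatible system of closed
edges fixed by `H` … `H` is contained in some edge-like subgroup, hence also in [a] verticial subgroup."

PROOF-ONLY (no definition; abc-iut cell, second seat abc-iut-w4-d029 for holder abc-iut-w4-d059, coordinator
abc-iut-w4-d085), over LOOSE BINDERS matching abc-iut-w4-d059's `arithMaximalCompactStatementI_of_levelData`
(`ArithCompactInVerticialConj2.lean`), whose hypothesis `hconj1` this file produces (for subgroups
satisfying (∗_j); (∗_j) for arithmetically ample compact subgroups is row T54-3a,
`hstar_of_isArithAmple`): a directed system of trees `T j` ("`𝒢_{∞,j}`") with a vertex, acted on by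
`Π^temp_𝔊 = Gtp` through `ρ j` with OPEN kernels ("this action factors through a finite quotient"),
functorial `Gtp`-equivariant transition morphisms `f`, NO branch switching at tree level (`hnoswap`, print's
"the arithmetic actions on the underlying graphs … do not switch the branches of any edge"), and the
arithmetic DICTIONARY as binders (producer's obligations, row T54-0; print p. 65 "the decomposition group
`Π^temp_{𝔊,v}` … `Π^temp_{𝔊,b} ⊆ Π^temp_{𝔊,v}`"): (AI2) `hstab` — the pointwise stabiliser of a compatible
system of tree vertices lies in a verticial subgroup; (AI3) `hedge` — the pointwise stabiliser of an
eventual compatible system of tree edges (with their branches) lies in an edge-like subgroup; `hEdgeVert`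
— every edge-like subgroup lies in a verticial one.

* `arith_exists_fixed_vertex` — one level: a compact `C` fixes a vertex of `T j` (finite image, Lemma 1.8
  (ii)(a), no branch switching; the GENERIC `SemiGraph.exists_fixed_vertex_of_noSwap`);
* `arith_exists_compatible_fixed_edges` — Comments (6)(b): above a level `j₀` where `C` fixes two vertices,
  (∗_j) yields a compatible system of `C`-fixed edges each with an abutting branch
  (`SemiGraph.exists_compatible_of_eventually_subsingleton_image`, abc-iut-L3-t6);
* `arith_conj1_of_hstar` — CLAUSE 1 for a compact `C` satisfying (∗_j): case (a) of Comments (6) (on a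
  cofinal set of levels `C` fixes exactly one vertex ⇒ compatible vertex system ⇒ `hstab`) or case (b)
  (eventually two fixed vertices ⇒ compatible edge system ⇒ `hedge` ⇒ `hEdgeVert`);
* `arith_conj1_of_hstar_ample` — the same in the currency of `hconj1` (arithmetically ample compact `C`,
  (∗_j) supplied for such `C`).

Only GENERIC tree-system lemmas are used; no statement of Thm 3.7 is consumed; nothing here asserts a
hypothesis of Thm 5.4 for any data or bears on [IUTchIII] Cor. 3.12; typed ≠ proved elsewhere.
-/

namespace Literature.AnabelianGeometry.SemiGraphs

open CategoryTheory Topology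

universe v u u' w w'

variable {Gtp : Type u} [Group Gtp] [TopologicalSpace Gtp] [IsTopologicalGroup Gtp]
variable {V : Type w} {B : Type w'}
variable (D : DecompositionData Gtp V B)
variable {J : Type v} [Preorder J] [IsDirectedOrder J]
  (T : J → SemiGraph.{u}) (ρ : ∀ j, Gtp →* Aut (T j)) (f : ∀ ⦃i j : J⦄, i ≤ j → (T j ⟶ T i))

/-! ### One level: a compact subgroup fixes a vertex -/

omit [Preorder J] [IsDirectedOrder J] in
/-- **One level of the proof** (p. 41 / p. 66: "this action factors through a finite quotient. In
particular, by Lemma 1.8, (ii), (a), `H` fixes at least one edge or vertex … if `H` fixes an edge, then it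
does not switch the branches of the edge … `H` always fixes at least one vertex"): a compact `C` acting on
the tree `T j` through `ρ j` (open kernel) without branch switching fixes a vertex.
[cite: MochizukiSemiAnbd2006, Thm 5.4 (i) p.66] -/
theorem arith_exists_fixed_vertex (hT : ∀ j, (T j).IsTree) (v₀ : ∀ j, (T j).Vertex)
    (hker : ∀ j, IsOpen ((ρ j).ker : Set Gtp))
    (hnoswap : ∀ (j : J) (g : Gtp) (b : (T j).Branch),
      (ρ j g).hom.edgeMap ((T j).edgeOf b) = (T j).edgeOf b → (ρ j g).hom.branchMap b = b)
    (C : Subgroup Gtp) (hC : IsCompact (C : Set Gtp)) (j : J) :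
    ∃ x : (T j).Vertex, ∀ γ : C, (ρ j γ).hom.vertexMap x = x :=
  SemiGraph.exists_fixed_vertex_of_noSwap (hT j)
    (fun e => SemiGraph.exists_abuts_of_isConnected ⟨(hT j).isTree.1⟩ (v₀ j) e) ((ρ j).restrict C)
    (SemiGraph.finite_range_restrict_of_isCompact (ρ j) (hker j) C hC)
    (fun γ b he => hnoswap j γ b he)

/-! ### Cofinal sets of levels: extension of compatible systems -/

omit [IsDirectedOrder J] in
/-- A cofinal subset of a directed preorder is directed. [folklore] -/
private theorem isDirectedOrder_of_cofinal (S : Set J) (hS : ∀ j : J, ∃ s ∈ S, j ≤ s)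
    [IsDirectedOrder J] : IsDirectedOrder S := by
  refine ⟨fun a b => ?_⟩
  obtain ⟨k, hak, hbk⟩ := exists_ge_ge a.1 b.1
  obtain ⟨s, hs, hks⟩ := hS k
  exact ⟨⟨s, hs⟩, hak.trans hks, hbk.trans hks⟩

/-! ### Comments (6)(b): the compatible system of fixed edges (generic directed index) -/

section FixedEdges

variable {K : Type v} [Preorder K] [IsDirectedOrder K]
  (T' : K → SemiGraph.{u}) (ρ' : ∀ k, Gtp →* Aut (T' k)) (f' : ∀ ⦃i j : K⦄, i ≤ j → (T' j ⟶ T' i))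

omit [TopologicalSpace Gtp] [IsTopologicalGroup Gtp] in
/-- **Comments (6)(b): the compatible system of fixed edges.** If at every level of a directed system
of trees a subgroup `C` fixes two distinct vertices and (∗_j) holds ("there exists an `i ≥ j` such that
`#E_{j,i} = 1`"), there is a compatible system of `C`-fixed edges each having a branch abutting to a vertex
("the unique elements of the `E_{j,∞}` form a compatible system of closed edges fixed by `H`"): the fixed
geodesic between two fixed vertices contains such an edge, these sets are stable under the transition maps,
and their images are eventually single points (abc-iut-L3-t6's
`SemiGraph.exists_compatible_of_eventually_subsingleton_image`). [cite: MochizukiSemiAnbd2006, Thm 5.4 (i) p.66] -/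
theorem arith_exists_compatible_fixed_edges (hT : ∀ k, (T' k).IsTree)
    (hf_comp : ∀ ⦃i j k : K⦄ (hij : i ≤ j) (hjk : j ≤ k) (e : (T' k).Edge),
      (f' hij).edgeMap ((f' hjk).edgeMap e) = (f' (hij.trans hjk)).edgeMap e)
    (hf_act : ∀ ⦃i j : K⦄ (h : i ≤ j) (g : Gtp) (e : (T' j).Edge),
      (f' h).edgeMap ((ρ' j g).hom.edgeMap e) = (ρ' i g).hom.edgeMap ((f' h).edgeMap e))
    (C : Subgroup Gtp)
    (htwo : ∀ k : K, ∃ a b : (T' k).Vertex, a ≠ b ∧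
      (∀ γ : C, (ρ' k γ).hom.vertexMap a = a) ∧ ∀ γ : C, (ρ' k γ).hom.vertexMap b = b)
    (hstar : ∀ j : K, ∃ (i : K) (h : j ≤ i), ∀ e e' : (T' i).Edge,
      (∀ γ : C, (ρ' i γ).hom.edgeMap e = e) → (∀ γ : C, (ρ' i γ).hom.edgeMap e' = e') →
      (f' h).edgeMap e = (f' h).edgeMap e') :
    ∃ ε : ∀ k, (T' k).Edge,
      (∀ k, (∃ (b : (T' k).Branch) (w : (T' k).Vertex),
        (T' k).edgeOf b = ε k ∧ (T' k).abuts b = some w) ∧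
        ∀ γ : C, (ρ' k γ).hom.edgeMap (ε k) = ε k) ∧
      ∀ ⦃i j : K⦄ (h : i ≤ j), (f' h).edgeMap (ε j) = ε i := by
  -- the sets `F_k` of fixed edges with an abutting branch
  let F : ∀ k, Set (T' k).Edge := fun k =>
    {e | (∃ (b : (T' k).Branch) (w : (T' k).Vertex), (T' k).edgeOf b = e ∧ (T' k).abuts b = some w) ∧
      ∀ γ : C, (ρ' k γ).hom.edgeMap e = e}
  have hne : ∀ k, (F k).Nonempty := by
    intro k
    obtain ⟨a, b, hab, ha, hb⟩ := htwo k
    have hA : (T' k).subdivision.IsAcyclic := (hT k).isTree.isAcyclic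
    obtain ⟨p, hp⟩ := (hT k).isTree.connected.exists_isPath (Sum.inl a) (Sum.inl b)
    have fixp : ∀ z ∈ p.support, ∀ γ : C, SemiGraph.nodeMap (ρ' k γ) z = z := fun z hz γ =>
      SemiGraph.nodeMap_eq_self_of_isPath hA (ρ' k γ) (by simp [ha γ]) (by simp [hb γ]) p hp z hz
    rcases SemiGraph.path_between_vertices_shape hab p hp with
      ⟨v, e₁, -, c₁, -, -, hc₁e, hc₁v, -, -, -, he₁s, -⟩ | ⟨e, c₀, -, -, hce, -, hca, -, hes⟩
    · exact ⟨e₁, ⟨c₁, v, hc₁e, hc₁v⟩, fun γ => by simpa using fixp _ he₁s γ⟩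
    · exact ⟨e, ⟨c₀, a, hce, hca⟩, fun γ => by simpa using fixp _ hes γ⟩
  have hmap : ∀ ⦃i j : K⦄ (h : i ≤ j) (x : (T' j).Edge), x ∈ F j → (f' h).edgeMap x ∈ F i := by
    rintro i j h x ⟨⟨b, w, hbx, hbw⟩, hfix⟩
    refine ⟨⟨(f' h).branchMap b, (f' h).vertexMap w, ?_, (f' h).abuts_branchMap b w hbw⟩, fun γ => ?_⟩
    · rw [(f' h).edgeOf_branchMap, hbx]
    · rw [← hf_act, hfix]
  have hstar' : ∀ j, ∃ (i : K) (h : j ≤ i), ((fun x => (f' h).edgeMap x) '' F i).Subsingleton := by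
    intro j
    obtain ⟨i, h, H⟩ := hstar j
    refine ⟨i, h, ?_⟩
    rintro _ ⟨e, he, rfl⟩ _ ⟨e', he', rfl⟩
    exact H e e' he.2 he'.2
  obtain ⟨ε, hεF, hεc⟩ := SemiGraph.exists_compatible_of_eventually_subsingleton_image
    (fun i j (h : i ≤ j) => (f' h).edgeMap) (fun i j k hij hjk x => hf_comp hij hjk x) F hne hmap hstar'
  exact ⟨ε, fun k => hεF k, hεc⟩

end FixedEdges

/-! ### Clause 1 under (∗_j) -/

/-- **[SemiAnbd] Thm 5.4 (i), CLAUSE 1, for a compact subgroup satisfying (∗_j)** (Comments (6)(a)(b)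
in the arithmetic setting): over a directed system of trees with `Gtp`-actions through open kernels,
functorial equivariant transition maps and no branch switching, with the arithmetic dictionary (AI2)
`hstab`, (AI3) `hedge` and `hEdgeVert` as binders, a compact `C` satisfying (∗_j) lies in a verticial
subgroup. Case (a): on a cofinal set of levels `C` fixes exactly one vertex — these form a compatible
system (uniqueness), extended to all levels along `f`, whose stabiliser is verticial by `hstab`. Case (b):
on a cofinal set of levels `C` fixes two vertices — `arith_exists_compatible_fixed_edges` on that cofinal
system ((∗_j) descends to it) gives a compatible system of fixed edges, extended to all levels above one of
them; `C` fixes it with its branches (no switching), so `C` lies in an edge-like subgroup by `hedge`, hence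
in a verticial one by `hEdgeVert`. [cite: MochizukiSemiAnbd2006, Thm 5.4 (i) p.66] -/
theorem arith_conj1_of_hstar (hT : ∀ j, (T j).IsTree) (v₀ : ∀ j, (T j).Vertex)
    (hker : ∀ j, IsOpen ((ρ j).ker : Set Gtp))
    (hf_comp : ∀ ⦃i j k : J⦄ (hij : i ≤ j) (hjk : j ≤ k), f hjk ≫ f hij = f (hij.trans hjk))
    (hf_act : ∀ ⦃i j : J⦄ (h : i ≤ j) (g : Gtp), (ρ j g).hom ≫ f h = f h ≫ (ρ i g).hom)
    (hnoswap : ∀ (j : J) (g : Gtp) (b : (T j).Branch),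
      (ρ j g).hom.edgeMap ((T j).edgeOf b) = (T j).edgeOf b → (ρ j g).hom.branchMap b = b)
    (hstab : ∀ x : ∀ j, (T j).Vertex, (∀ ⦃i j : J⦄ (h : i ≤ j), (f h).vertexMap (x j) = x i) →
      ∃ W : Subgroup Gtp, IsVerticial D W ∧
        ∀ g : Gtp, (∀ j, (ρ j g).hom.vertexMap (x j) = x j) → g ∈ W)
    (hedge : ∀ (j₁ : J) (ε : ∀ j : {j : J // j₁ ≤ j}, (T j.1).Edge),
      (∀ ⦃i j : {j : J // j₁ ≤ j}⦄ (h : i.1 ≤ j.1), (f h).edgeMap (ε j) = ε i) →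
      ∃ L : Subgroup Gtp, IsEdgeLike D L ∧
        ∀ g : Gtp, (∀ j, (ρ j.1 g).hom.edgeMap (ε j) = ε j ∧
          ∀ b : (T j.1).Branch, (T j.1).edgeOf b = ε j → (ρ j.1 g).hom.branchMap b = b) → g ∈ L)
    (hEdgeVert : ∀ L : Subgroup Gtp, IsEdgeLike D L → ∃ W : Subgroup Gtp, IsVerticial D W ∧ L ≤ W)
    (C : Subgroup Gtp) (hC : IsCompact (C : Set Gtp))
    (hstar : ∀ j : J, ∃ (i : J) (h : j ≤ i), ∀ e e' : (T i).Edge,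
      (∀ γ : C, (ρ i γ).hom.edgeMap e = e) → (∀ γ : C, (ρ i γ).hom.edgeMap e' = e') →
      (f h).edgeMap e = (f h).edgeMap e') :
    ∃ W : Subgroup Gtp, IsVerticial D W ∧ C ≤ W := by
  -- pointwise forms of functoriality / equivariance
  have hf_comp_v : ∀ ⦃i j k : J⦄ (hij : i ≤ j) (hjk : j ≤ k) (x : (T k).Vertex),
      (f hij).vertexMap ((f hjk).vertexMap x) = (f (hij.trans hjk)).vertexMap x := by
    intro i j k hij hjk x
    rw [← hf_comp hij hjk, SemiGraph.comp_vertexMap, Function.comp_apply]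
  have hf_comp_e : ∀ ⦃i j k : J⦄ (hij : i ≤ j) (hjk : j ≤ k) (e : (T k).Edge),
      (f hij).edgeMap ((f hjk).edgeMap e) = (f (hij.trans hjk)).edgeMap e := by
    intro i j k hij hjk e
    rw [← hf_comp hij hjk, SemiGraph.comp_edgeMap, Function.comp_apply]
  have hact_v : ∀ ⦃i j : J⦄ (h : i ≤ j) (g : Gtp) (x : (T j).Vertex),
      (f h).vertexMap ((ρ j g).hom.vertexMap x) = (ρ i g).hom.vertexMap ((f h).vertexMap x) := by
    intro i j h g x
    have he := congrArg (fun φ => SemiGraph.Hom.vertexMap φ x) (hf_act h g)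
    simpa only [SemiGraph.comp_vertexMap, Function.comp_apply] using he
  have hact_e : ∀ ⦃i j : J⦄ (h : i ≤ j) (g : Gtp) (e : (T j).Edge),
      (f h).edgeMap ((ρ j g).hom.edgeMap e) = (ρ i g).hom.edgeMap ((f h).edgeMap e) := by
    intro i j h g e
    have he := congrArg (fun φ => SemiGraph.Hom.edgeMap φ e) (hf_act h g)
    simpa only [SemiGraph.comp_edgeMap, Function.comp_apply] using he
  -- the fixed-vertex sets, nonempty and stable under the transition maps
  let Fix : ∀ j, Set (T j).Vertex := fun j => {x | ∀ γ : C, (ρ j γ).hom.vertexMap x = x}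
  have hFix_ne : ∀ j, (Fix j).Nonempty := fun j =>
    arith_exists_fixed_vertex T ρ hT v₀ hker hnoswap C hC j
  have hFix_map : ∀ ⦃i j : J⦄ (h : i ≤ j) (x : (T j).Vertex), x ∈ Fix j → (f h).vertexMap x ∈ Fix i :=
    fun i j h x hx γ => by
      show (ρ i γ).hom.vertexMap ((f h).vertexMap x) = (f h).vertexMap x
      rw [← hact_v, hx γ]
  -- a choice of a cofinal level above each level, for any cofinal set
  have extend : ∀ (S : Set J), (∀ j : J, ∃ s ∈ S, j ≤ s) → ∃ ab : J → S, ∀ j, j ≤ (ab j).1 :=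
    fun S hS => ⟨fun j => ⟨(hS j).choose, (hS j).choose_spec.1⟩, fun j => (hS j).choose_spec.2⟩
  -- the degenerate case of an empty index set: the empty system is compatible and fixed by everything
  rcases isEmpty_or_nonempty J with hJ | ⟨⟨jstar⟩⟩
  · obtain ⟨W, hW, hWstab⟩ := hstab (fun j => isEmptyElim j) (fun i => isEmptyElim i)
    exact ⟨W, hW, fun g _ => hWstab g fun j => isEmptyElim j⟩
  rcases ProfiniteSemiGraph.cofinal_dichotomy (fun j => (Fix j).Subsingleton) with hA | hB
  · -- case (a): on the cofinal set `S` of levels with a unique fixed vertex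
    let S : Set J := {s | (Fix s).Subsingleton}
    have hS : ∀ j : J, ∃ s ∈ S, j ≤ s := fun j => let ⟨s, hs, hjs⟩ := hA j; ⟨s, hs, hjs⟩
    haveI : IsDirectedOrder S := isDirectedOrder_of_cofinal (J := J) S hS
    have hu' : ∀ s : S, ∃ u : (T s.1).Vertex, u ∈ Fix s.1 := fun s => hFix_ne s.1
    choose u hu using hu'
    have hu_compat : ∀ ⦃s t : S⦄ (h : s.1 ≤ t.1), (f h).vertexMap (u t) = u s :=
      fun s t h => s.2 (hFix_map h (u t) (hu t)) (hu s)
    obtain ⟨ab, hab⟩ := extend S hS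
    -- the extended compatible system and its stabiliser
    let x : ∀ j, (T j).Vertex := fun j => (f (hab j)).vertexMap (u (ab j))
    have hx_compat : ∀ ⦃i j : J⦄ (h : i ≤ j), (f h).vertexMap (x j) = x i := by
      intro i j h
      obtain ⟨t, hit, hjt⟩ := exists_ge_ge (ab i) (ab j)
      show (f h).vertexMap ((f (hab j)).vertexMap (u (ab j))) = (f (hab i)).vertexMap (u (ab i))
      rw [← hu_compat (show (ab j).1 ≤ t.1 from hjt), ← hu_compat (show (ab i).1 ≤ t.1 from hit),
        hf_comp_v, hf_comp_v, hf_comp_v]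
    have hx_fix : ∀ g : Gtp, g ∈ C → ∀ j, (ρ j g).hom.vertexMap (x j) = x j := by
      intro g hg j
      show (ρ j g).hom.vertexMap ((f (hab j)).vertexMap (u (ab j))) = (f (hab j)).vertexMap (u (ab j))
      rw [← hact_v, hu (ab j) ⟨g, hg⟩]
    obtain ⟨W, hW, hWstab⟩ := hstab x hx_compat
    exact ⟨W, hW, fun g hg => hWstab g (hx_fix g hg)⟩
  · -- case (b): on the cofinal set `S` of levels with two fixed vertices
    let S : Set J := {s | ¬ (Fix s).Subsingleton}
    have hS : ∀ j : J, ∃ s ∈ S, j ≤ s := fun j => let ⟨s, hs, hjs⟩ := hB j; ⟨s, hs, hjs⟩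
    haveI : IsDirectedOrder S := isDirectedOrder_of_cofinal (J := J) S hS
    have htwo : ∀ s : S, ∃ a b : (T s.1).Vertex, a ≠ b ∧
        (∀ γ : C, (ρ s.1 γ).hom.vertexMap a = a) ∧ ∀ γ : C, (ρ s.1 γ).hom.vertexMap b = b := by
      intro s
      have hs : ¬ (Fix s.1).Subsingleton := s.2
      rw [Set.not_subsingleton_iff] at hs
      obtain ⟨a, ha, b, hb, hab⟩ := hs
      exact ⟨a, b, hab, ha, hb⟩
    -- (∗_j) descends to the cofinal system
    have hstarS : ∀ s : S, ∃ (t : S) (h : s ≤ t), ∀ e e' : (T t.1).Edge,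
        (∀ γ : C, (ρ t.1 γ).hom.edgeMap e = e) → (∀ γ : C, (ρ t.1 γ).hom.edgeMap e' = e') →
        (f (show s.1 ≤ t.1 from h)).edgeMap e = (f (show s.1 ≤ t.1 from h)).edgeMap e' := by
      intro s
      obtain ⟨i, hsi, H⟩ := hstar s.1
      obtain ⟨t, ht, hit⟩ := hS i
      refine ⟨⟨t, ht⟩, hsi.trans hit, fun e e' he he' => ?_⟩
      show (f (hsi.trans hit)).edgeMap e = (f (hsi.trans hit)).edgeMap e'
      rw [← hf_comp_e hsi hit e, ← hf_comp_e hsi hit e']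
      exact H _ _ (fun γ => by rw [← hact_e, he γ]) (fun γ => by rw [← hact_e, he' γ])
    obtain ⟨ε, hε, hεc⟩ := arith_exists_compatible_fixed_edges (fun s : S => T s.1) (fun s => ρ s.1)
      (fun i j h => f (show i.1 ≤ j.1 from h)) (fun s => hT s.1)
      (fun i j k hij hjk e => hf_comp_e (show i.1 ≤ j.1 from hij) (show j.1 ≤ k.1 from hjk) e)
      (fun i j h g e => hact_e (show i.1 ≤ j.1 from h) g e) C htwo hstarS
    -- extension of the edge system to all levels above the fixed level `s₁ := ab jstar ∈ S`
    obtain ⟨ab, hab⟩ := extend S hS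
    let s₁ : S := ab jstar
    let ε' : ∀ k : {k : J // s₁.1 ≤ k}, (T k.1).Edge := fun k => (f (hab k.1)).edgeMap (ε (ab k.1))
    have hε'c : ∀ ⦃i k : {k : J // s₁.1 ≤ k}⦄ (h : i.1 ≤ k.1), (f h).edgeMap (ε' k) = ε' i := by
      intro i k h
      obtain ⟨t, hit, hkt⟩ := exists_ge_ge (ab i.1) (ab k.1)
      show (f h).edgeMap ((f (hab k.1)).edgeMap (ε (ab k.1))) = (f (hab i.1)).edgeMap (ε (ab i.1))
      rw [← hεc (show ab k.1 ≤ t from hkt), ← hεc (show ab i.1 ≤ t from hit)]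
      show (f h).edgeMap ((f (hab k.1)).edgeMap ((f (show (ab k.1).1 ≤ t.1 from hkt)).edgeMap (ε t))) =
        (f (hab i.1)).edgeMap ((f (show (ab i.1).1 ≤ t.1 from hit)).edgeMap (ε t))
      rw [hf_comp_e, hf_comp_e, hf_comp_e]
    have hε'fix : ∀ g : Gtp, g ∈ C → ∀ k : {k : J // s₁.1 ≤ k}, (ρ k.1 g).hom.edgeMap (ε' k) = ε' k := by
      intro g hg k
      show (ρ k.1 g).hom.edgeMap ((f (hab k.1)).edgeMap (ε (ab k.1))) = (f (hab k.1)).edgeMap (ε (ab k.1))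
      rw [← hact_e, (hε (ab k.1)).2 ⟨g, hg⟩]
    -- the edge-like subgroup of the extended system contains `C`, and lies in a verticial subgroup
    obtain ⟨L, hL, hLstab⟩ := hedge s₁.1 ε' hε'c
    have hCL : C ≤ L := fun g hg =>
      hLstab g fun k => ⟨hε'fix g hg k, fun b hb => hnoswap k.1 g b (by rw [hb]; exact hε'fix g hg k)⟩
    obtain ⟨W, hW, hLW⟩ := hEdgeVert L hL
    exact ⟨W, hW, hCL.trans hLW⟩

/-- **[SemiAnbd] Thm 5.4 (i), CLAUSE 1 in the currency of `hconj1`** of abc-iut-w4-d059's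
`arithMaximalCompactStatementI_of_levelData`: every ARITHMETICALLY AMPLE compact subgroup lies in a
verticial subgroup, given (∗_j) for such subgroups (row T54-3a `hstar_of_isArithAmple`: total arithmetic
estrangement) and the level data. [cite: MochizukiSemiAnbd2006, Thm 5.4 (i) p.66] -/
theorem arith_conj1_of_hstar_ample {PA : Type u'} [Group PA] [TopologicalSpace PA] (aug : Gtp →* PA)
    (hT : ∀ j, (T j).IsTree) (v₀ : ∀ j, (T j).Vertex)
    (hker : ∀ j, IsOpen ((ρ j).ker : Set Gtp))
    (hf_comp : ∀ ⦃i j k : J⦄ (hij : i ≤ j) (hjk : j ≤ k), f hjk ≫ f hij = f (hij.trans hjk))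
    (hf_act : ∀ ⦃i j : J⦄ (h : i ≤ j) (g : Gtp), (ρ j g).hom ≫ f h = f h ≫ (ρ i g).hom)
    (hnoswap : ∀ (j : J) (g : Gtp) (b : (T j).Branch),
      (ρ j g).hom.edgeMap ((T j).edgeOf b) = (T j).edgeOf b → (ρ j g).hom.branchMap b = b)
    (hstab : ∀ x : ∀ j, (T j).Vertex, (∀ ⦃i j : J⦄ (h : i ≤ j), (f h).vertexMap (x j) = x i) →
      ∃ W : Subgroup Gtp, IsVerticial D W ∧
        ∀ g : Gtp, (∀ j, (ρ j g).hom.vertexMap (x j) = x j) → g ∈ W)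
    (hedge : ∀ (j₁ : J) (ε : ∀ j : {j : J // j₁ ≤ j}, (T j.1).Edge),
      (∀ ⦃i j : {j : J // j₁ ≤ j}⦄ (h : i.1 ≤ j.1), (f h).edgeMap (ε j) = ε i) →
      ∃ L : Subgroup Gtp, IsEdgeLike D L ∧
        ∀ g : Gtp, (∀ j, (ρ j.1 g).hom.edgeMap (ε j) = ε j ∧
          ∀ b : (T j.1).Branch, (T j.1).edgeOf b = ε j → (ρ j.1 g).hom.branchMap b = b) → g ∈ L)
    (hEdgeVert : ∀ L : Subgroup Gtp, IsEdgeLike D L → ∃ W : Subgroup Gtp, IsVerticial D W ∧ L ≤ W)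
    (hstar : ∀ C : Subgroup Gtp, IsCompact (C : Set Gtp) → IsArithAmple aug C →
      ∀ j : J, ∃ (i : J) (h : j ≤ i), ∀ e e' : (T i).Edge,
        (∀ γ : C, (ρ i γ).hom.edgeMap e = e) → (∀ γ : C, (ρ i γ).hom.edgeMap e' = e') →
        (f h).edgeMap e = (f h).edgeMap e')
    (C : Subgroup Gtp) (hC : IsCompact (C : Set Gtp)) (hCA : IsArithAmple aug C) :
    ∃ W : Subgroup Gtp, IsVerticial D W ∧ C ≤ W :=
  arith_conj1_of_hstar D T ρ f hT v₀ hker hf_comp hf_act hnoswap hstab hedge hEdgeVert C hC (hstar C hC hCA)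

end Literature.AnabelianGeometry.SemiGraphs
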